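import Summits.RiemannHypothesis.RiemannHypothesis.Theorems.SemilocalNegCertEleven
import Summits.RiemannHypothesis.RiemannHypothesis.Theorems.SemilocalLogAtomsB
import Summits.RiemannHypothesis.RiemannHypothesis.Theorems.SemilocalLogAtomsC
import HarnessLib

/-!
# Semi-local threshold of the `{∞} ∪ {p < 41}` form, negative side: `a*({2,…,37}) ≤ 15/8` (the wall `q = 41`)

Cell `rh-explicit` (HOME `run/shared/lean/pub/rh-explicit/`), seat cc-s2-4 gen8 (A4-EXT item (1): theorem upper ends for the walls
`q ≤ 53`; `S = S_41 = {2, 3, 5, 7, 11, 13, 17, 19, 23, 29, 31, 37}`, class `2, …, 37 ∈ S ∌ 41`).  Honest framing: theorems about the tree's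
`weilSemilocalThreshold S`; nothing here bears on RH.  No data is trusted: 11 kernel facts (`decide +kernel`) of the PIECEWISE
certificate `certUptoThirtySeven` (`WeilNegCertP`, `SemilocalNegCertPieces.lean`; window `2b = 15 / 4`, bulk in 9 pieces,
centred majorant `archMajorCL 10 4 5 u₀`).

Instance data: window `N = 42` (`2b < log 43`), atoms = the `S`-smooth prime powers `≤ 42`:
`2, 3, 4, 5, 7, 8, 9, 11, 13, 16, 17, 19, 23, 25, 27, 29, 31, 32, 37` (enclosures `SemilocalLogAtoms{,B,C}.lean`).  Witness: bottom vector of the odd Legendre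
section `d = 13` at `b = 15/8` from this seat's exact-kappa finder (`polyfind.py`, HOME/cc-s2-4/gen7/): `Re Q_S(G)/‖G‖² =
−1.6478·10⁻⁴` ⇒ **`weilSemilocalThreshold {2, 3, 5, 7, 11, 13, 17, 19, 23, 29, 31, 37} ≤ 15/8`**.  The window sits just beyond the KNEE of the wall
(`b ≈ a*(S_41) + 0.01`: past it the finite-degree sections turn strongly negative and degree 13 suffices; closer to `a*`
the same witness class needs degree ≥ 25 — gen7, CC4-LEAN §12.5; knee table CC4-LEAN §13).  Locality (`N = 42`): **`a*(S) = a*(S_41) ∈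
[0.8046, 15/8]` for every finite `S ⊇ S_41` with `41 ∉ S`** (DATA: a*(S_41) ∈ (1.856844, 1.856850] (cc6, N = 400)).  Folklore throughout.
-/

set_option autoImplicit false
set_option linter.dupNamespace false  -- the mandated namespace repeats `RiemannHypothesis`

noncomputable section

open Complex Filter Set MeasureTheory Topology
open scoped Real

namespace Summit.RiemannHypothesis.RiemannHypothesis.Theorems.SemilocalPolyWitness

open MeasureTheory Set Finset Real
open Literature.NumberTheory.LFunctions
open Summit.RiemannHypothesis.RiemannHypothesis.Theorems.MotivicDoor
open Summit.RiemannHypothesis.RiemannHypothesis.Theorems.MotivicDoor.SemilocalThreshold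
open Summit.RiemannHypothesis.RiemannHypothesis.Theorems.MotivicDoor.SemilocalMarkov
open LQ


/-! ### The atom table of the `{2, 3, 5, 7, 11, 13, 17, 19, 23, 29, 31, 37}`-form on windows `b < (log 43)/2` (`N = 42`) -/

/-- The atoms of the `{2, 3, 5, 7, 11, 13, 17, 19, 23, 29, 31, 37}`-form below `(log 43)/2`: `2, 3, 4, 5, 7, 8, 9, 11, 13, 16, 17, 19, 23, 25, 27, 29, 31, 32, 37`. -/
def atomsUptoThirtySeven : List (ℕ × AtomQ) := [atomTwo, atomThree, atomFour, atomFive, atomSeven, atomEight, atomNine, atomEleven, atomThirteen, atomSixteen, atomSeventeen, atomNineteen, atomTwentyThree, atomTwentyFive, atomTwentySeven, atomTwentyNine, atomThirtyOne, atomThirtyTwo, atomThirtySeven]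

/-- A rational lower bound of `log 43`. -/
def logSuccLoUptoThirtySeven : ℚ := logFortyThreeLo

/-- **The atom table encloses `({2, 3, 5, 7, 11, 13, 17, 19, 23, 29, 31, 37}, 42)`.** -/
theorem atomsEnclose_UptoThirtySeven : AtomsEnclose {2, 3, 5, 7, 11, 13, 17, 19, 23, 29, 31, 37} 42 atomsUptoThirtySeven logSuccLoUptoThirtySeven where
  nodup := by decide
  lt_succ := by decide
  cover := by
    intro n hn hnot
    simp only [atomsUptoThirtySeven, atomTwo, atomThree, atomFour, atomFive, atomSeven, atomEight, atomNine, atomEleven, atomThirteen, atomSixteen, atomSeventeen, atomNineteen, atomTwentyThree, atomTwentyFive, atomTwentySeven, atomTwentyNine, atomThirtyOne, atomThirtyTwo, atomThirtySeven, List.map_cons, List.map_nil, List.mem_cons,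
      List.not_mem_nil, or_false, not_or] at hnot
    have hn' : n < 43 := Finset.mem_range.1 hn
    interval_cases n
    · exact weilSemilocalCoeff_of_not_isPrimePow _ (by decide)
    · exact weilSemilocalCoeff_of_not_isPrimePow _ (by decide)
    · simp at hnot
    · simp at hnot
    · simp at hnot
    · simp at hnot
    · exact weilSemilocalCoeff_of_not_isPrimePow _ (by decide)
    · simp at hnot
    · simp at hnot
    · simp at hnot
    · exact weilSemilocalCoeff_of_not_isPrimePow _ (by decide)
    · simp at hnot
    · exact weilSemilocalCoeff_of_not_isPrimePow _ (by decide)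
    · simp at hnot
    · exact weilSemilocalCoeff_of_not_isPrimePow _ (by decide)
    · exact weilSemilocalCoeff_of_not_isPrimePow _ (not_isPrimePow_of_two_primes_dvd Nat.prime_three (by norm_num : Nat.Prime 5) (by norm_num) (by norm_num) (by norm_num))
    · simp at hnot
    · simp at hnot
    · exact weilSemilocalCoeff_of_not_isPrimePow _ (by decide)
    · simp at hnot
    · exact weilSemilocalCoeff_of_not_isPrimePow _ (by decide)
    · exact weilSemilocalCoeff_of_not_isPrimePow _ (not_isPrimePow_of_two_primes_dvd Nat.prime_three (by norm_num : Nat.Prime 7) (by norm_num) (by norm_num) (by norm_num))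
    · exact weilSemilocalCoeff_of_not_isPrimePow _ (by decide)
    · simp at hnot
    · exact weilSemilocalCoeff_of_not_isPrimePow _ (by decide)
    · simp at hnot
    · exact weilSemilocalCoeff_of_not_isPrimePow _ (by decide)
    · simp at hnot
    · exact weilSemilocalCoeff_of_not_isPrimePow _ (by decide)
    · simp at hnot
    · exact weilSemilocalCoeff_of_not_isPrimePow _ (by decide)
    · simp at hnot
    · simp at hnot
    · exact weilSemilocalCoeff_of_not_isPrimePow _ (not_isPrimePow_of_two_primes_dvd Nat.prime_three (by norm_num : Nat.Prime 11) (by norm_num) (by norm_num) (by norm_num))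
    · exact weilSemilocalCoeff_of_not_isPrimePow _ (by decide)
    · exact weilSemilocalCoeff_of_not_isPrimePow _ (not_isPrimePow_of_two_primes_dvd (by norm_num : Nat.Prime 5) (by norm_num : Nat.Prime 7) (by norm_num) (by norm_num) (by norm_num))
    · exact weilSemilocalCoeff_of_not_isPrimePow _ (by decide)
    · simp at hnot
    · exact weilSemilocalCoeff_of_not_isPrimePow _ (by decide)
    · exact weilSemilocalCoeff_of_not_isPrimePow _ (not_isPrimePow_of_two_primes_dvd Nat.prime_three (by norm_num : Nat.Prime 13) (by norm_num) (by norm_num) (by norm_num))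
    · exact weilSemilocalCoeff_of_not_isPrimePow _ (by decide)
    · exact weilSemilocalCoeff_prime_of_not_mem (by norm_num) (by decide)
    · exact weilSemilocalCoeff_of_not_isPrimePow _ (by decide)
  encl := by
    intro na hna
    simp only [atomsUptoThirtySeven, List.mem_cons, List.not_mem_nil, or_false] at hna
    rcases hna with rfl | rfl | rfl | rfl | rfl | rfl | rfl | rfl | rfl | rfl | rfl | rfl | rfl | rfl | rfl | rfl | rfl | rfl | rfl
    · exact atomTwo_encl (by decide)
    · exact atomThree_encl (by decide)
    · exact atomFour_encl (by decide)
    · exact atomFive_encl (by decide)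
    · exact atomSeven_encl (by decide)
    · exact atomEight_encl (by decide)
    · exact atomNine_encl (by decide)
    · exact atomEleven_encl (by decide)
    · exact atomThirteen_encl (by decide)
    · exact atomSixteen_encl (by decide)
    · exact atomSeventeen_encl (by decide)
    · exact atomNineteen_encl (by decide)
    · exact atomTwentyThree_encl (by decide)
    · exact atomTwentyFive_encl (by decide)
    · exact atomTwentySeven_encl (by decide)
    · exact atomTwentyNine_encl (by decide)
    · exact atomThirtyOne_encl (by decide)
    · exact atomThirtyTwo_encl (by decide)
    · exact atomThirtySeven_encl (by decide)
  logSucc := by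
    have h43 := logFortyThreeLo_le
    have e : Real.log (((42 : ℕ) : ℝ) + 1) = Real.log 43 := by norm_num
    rw [e, logSuccLoUptoThirtySeven]; exact h43

/-! ### The certificates -/

/-- The degree-13 witness at `b = 15 / 8` (bottom vector of the odd Legendre section d = 13 at b = 15/8, rounded to 8 digits; exact-kappa finder value Re Q_S/‖G‖² = −1.6478·10⁻⁴; kernel margin (rhs − lhs)/‖G‖² = 1.31e-4), in powers of `x`. -/
def pUptoThirtySeven : List ℚ :=
  [0, -140474196233 / 960, 0, 852312453686 / 675, 0, -242305283243968 / 84375, 0, 10028747947851776 / 3796875, 0, -8749858804959281152 / 7688671875, 0, 666786305678029881344 / 2883251953125, 0, -1398547110647212015616 / 77847802734375]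

/-- The piecewise certificate at `b = 15 / 8`: orders `(nA, mA, KA, Kt, nt, ne) = (10, 4, 5, 10, 40, 16)`, cuts `[1, 3 / 2, 19 / 10, 11 / 5, 5 / 2, 57 / 20, 16 / 5, 173 / 50, 15 / 4]`,
claimed piece bounds and atom bound (exact rational values rounded up to integers). -/
def certUptoThirtySeven : WeilNegCertP :=
  ⟨pUptoThirtySeven, 15 / 8, 10, 4, 5, 10, 40, 16, atomsUptoThirtySeven, logSuccLoUptoThirtySeven,
   [1, 3 / 2, 19 / 10, 11 / 5, 5 / 2, 57 / 20, 16 / 5, 173 / 50, 15 / 4],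
   [22094273174659395, 6070228775588274, 3106143923244314, 2354438105097216, 1849128964153333, 1523324340124886, 2025291568992338, 1162517309904470, 949235313058230], 202100597101266216⟩

set_option maxHeartbeats 0 in
/-- kernel fact: side conditions and the final inequality of `certUptoThirtySeven`. -/
theorem check_UptoThirtySeven_main : certUptoThirtySeven.checkMain c0SharpQ = true := by
  decide +kernel

set_option maxHeartbeats 0 in
/-- kernel fact: the atom side of `certUptoThirtySeven`. -/
theorem check_UptoThirtySeven_atoms : certUptoThirtySeven.checkAtoms = true := by
  decide +kernel

set_option maxHeartbeats 0 in
/-- kernel fact: piece `0` of `certUptoThirtySeven`. -/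
theorem check_UptoThirtySeven_piece0 : certUptoThirtySeven.checkPiece 0 = true := by
  decide +kernel

set_option maxHeartbeats 0 in
/-- kernel fact: piece `1` of `certUptoThirtySeven`. -/
theorem check_UptoThirtySeven_piece1 : certUptoThirtySeven.checkPiece 1 = true := by
  decide +kernel

set_option maxHeartbeats 0 in
/-- kernel fact: piece `2` of `certUptoThirtySeven`. -/
theorem check_UptoThirtySeven_piece2 : certUptoThirtySeven.checkPiece 2 = true := by
  decide +kernel

set_option maxHeartbeats 0 in
/-- kernel fact: piece `3` of `certUptoThirtySeven`. -/
theorem check_UptoThirtySeven_piece3 : certUptoThirtySeven.checkPiece 3 = true := by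
  decide +kernel

set_option maxHeartbeats 0 in
/-- kernel fact: piece `4` of `certUptoThirtySeven`. -/
theorem check_UptoThirtySeven_piece4 : certUptoThirtySeven.checkPiece 4 = true := by
  decide +kernel

set_option maxHeartbeats 0 in
/-- kernel fact: piece `5` of `certUptoThirtySeven`. -/
theorem check_UptoThirtySeven_piece5 : certUptoThirtySeven.checkPiece 5 = true := by
  decide +kernel

set_option maxHeartbeats 0 in
/-- kernel fact: piece `6` of `certUptoThirtySeven`. -/
theorem check_UptoThirtySeven_piece6 : certUptoThirtySeven.checkPiece 6 = true := by
  decide +kernel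

set_option maxHeartbeats 0 in
/-- kernel fact: piece `7` of `certUptoThirtySeven`. -/
theorem check_UptoThirtySeven_piece7 : certUptoThirtySeven.checkPiece 7 = true := by
  decide +kernel

set_option maxHeartbeats 0 in
/-- kernel fact: piece `8` of `certUptoThirtySeven`. -/
theorem check_UptoThirtySeven_piece8 : certUptoThirtySeven.checkPiece 8 = true := by
  decide +kernel

/-- all pieces of `certUptoThirtySeven` check. -/
theorem check_UptoThirtySeven_pieces : ∀ i, i < certUptoThirtySeven.cuts.length → certUptoThirtySeven.checkPiece i = true := by
  intro i hi
  have hi' : i < 9 := hi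
  interval_cases i
  · exact check_UptoThirtySeven_piece0
  · exact check_UptoThirtySeven_piece1
  · exact check_UptoThirtySeven_piece2
  · exact check_UptoThirtySeven_piece3
  · exact check_UptoThirtySeven_piece4
  · exact check_UptoThirtySeven_piece5
  · exact check_UptoThirtySeven_piece6
  · exact check_UptoThirtySeven_piece7
  · exact check_UptoThirtySeven_piece8

/-! ### The theorems -/

/-- **`a*({2,…,37}) ≤ 15/8`.** -/
theorem weilSemilocalThreshold_uptoThirtySeven_le :
    weilSemilocalThreshold {2, 3, 5, 7, 11, 13, 17, 19, 23, 29, 31, 37} ≤ ((15 / 8 : ℚ) : ℝ) :=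
  weilSemilocalThreshold_le_of_checkP_sharp certUptoThirtySeven atomsEnclose_UptoThirtySeven
    check_UptoThirtySeven_main check_UptoThirtySeven_atoms check_UptoThirtySeven_pieces

/-- Failure form: positivity of the `{∞} ∪ S_41` form fails on every cone `C(B)`, `B > 15/8`. -/
theorem not_weilSemilocalPositivityOn_uptoThirtySeven_of_gt {B : ℝ} (hB : (15 / 8 : ℝ) < B) :
    ¬ WeilSemilocalPositivityOn {2, 3, 5, 7, 11, 13, 17, 19, 23, 29, 31, 37} B := by
  rw [not_weilSemilocalPositivityOn_iff_weilSemilocalThreshold_lt]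
  have h := weilSemilocalThreshold_uptoThirtySeven_le
  push_cast at h
  linarith

/-- `a*({2,…,37}) < (log 43)/2`: below the window of the next index. -/
theorem weilSemilocalThreshold_uptoThirtySeven_lt_log_fortythree_half :
    weilSemilocalThreshold {2, 3, 5, 7, 11, 13, 17, 19, 23, 29, 31, 37} < Real.log 43 / 2 := by
  have h := weilSemilocalThreshold_uptoThirtySeven_le
  have h43 := log_fortythree_gt
  push_cast at h
  linarith

/-- **The class `2, …, 37 ∈ S ∌ 41`**: `a*(S) = a*({2,…,37})` (locality at `N = 42`). -/
theorem weilSemilocalThreshold_eq_uptoThirtySeven {S : Finset ℕ} (h2 : 2 ∈ S) (h3 : 3 ∈ S) (h5 : 5 ∈ S) (h7 : 7 ∈ S) (h11 : 11 ∈ S) (h13 : 13 ∈ S) (h17 : 17 ∈ S) (h19 : 19 ∈ S) (h23 : 23 ∈ S) (h29 : 29 ∈ S) (h31 : 31 ∈ S) (h37 : 37 ∈ S)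
    (h41 : 41 ∉ S) : weilSemilocalThreshold S = weilSemilocalThreshold {2, 3, 5, 7, 11, 13, 17, 19, 23, 29, 31, 37} := by
  refine weilSemilocalThreshold_congr (S := {2, 3, 5, 7, 11, 13, 17, 19, 23, 29, 31, 37}) (S' := S) (N := 42) ?_ ?_
  · intro n hn hpp
    interval_cases n
    · exact absurd hpp (by decide)
    · exact absurd hpp (by decide)
    · rw [Nat.prime_two.primeFactors]; simp [h2]
    · rw [Nat.prime_three.primeFactors]; simp [h3]
    · rw [show (4 : ℕ) = 2 ^ 2 by norm_num, Nat.primeFactors_prime_pow two_ne_zero Nat.prime_two]; simp [h2]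
    · rw [(by norm_num : Nat.Prime 5).primeFactors]; simp [h5]
    · exact absurd hpp (by decide)
    · rw [(by norm_num : Nat.Prime 7).primeFactors]; simp [h7]
    · rw [show (8 : ℕ) = 2 ^ 3 by norm_num, Nat.primeFactors_prime_pow (by norm_num) Nat.prime_two]; simp [h2]
    · rw [show (9 : ℕ) = 3 ^ 2 by norm_num, Nat.primeFactors_prime_pow two_ne_zero Nat.prime_three]; simp [h3]
    · exact absurd hpp (by decide)
    · rw [(by norm_num : Nat.Prime 11).primeFactors]; simp [h11]
    · exact absurd hpp (by decide)
    · rw [(by norm_num : Nat.Prime 13).primeFactors]; simp [h13]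
    · exact absurd hpp (by decide)
    · exact absurd hpp (not_isPrimePow_of_two_primes_dvd Nat.prime_three (by norm_num : Nat.Prime 5) (by norm_num)
        (by norm_num) (by norm_num))
    · rw [show (16 : ℕ) = 2 ^ 4 by norm_num, Nat.primeFactors_prime_pow (by norm_num) Nat.prime_two]; simp [h2]
    · rw [(by norm_num : Nat.Prime 17).primeFactors]; simp [h17]
    · exact absurd hpp (by decide)
    · rw [(by norm_num : Nat.Prime 19).primeFactors]; simp [h19]
    · exact absurd hpp (by decide)
    · exact absurd hpp (not_isPrimePow_of_two_primes_dvd Nat.prime_three (by norm_num : Nat.Prime 7) (by norm_num)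
        (by norm_num) (by norm_num))
    · exact absurd hpp (by decide)
    · rw [(by norm_num : Nat.Prime 23).primeFactors]; simp [h23]
    · exact absurd hpp (by decide)
    · rw [show (25 : ℕ) = 5 ^ 2 by norm_num, Nat.primeFactors_prime_pow two_ne_zero (by norm_num : Nat.Prime 5)]; simp [h5]
    · exact absurd hpp (by decide)
    · rw [show (27 : ℕ) = 3 ^ 3 by norm_num, Nat.primeFactors_prime_pow (by norm_num) Nat.prime_three]; simp [h3]
    · exact absurd hpp (by decide)
    · rw [(by norm_num : Nat.Prime 29).primeFactors]; simp [h29]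
    · exact absurd hpp (by decide)
    · rw [(by norm_num : Nat.Prime 31).primeFactors]; simp [h31]
    · rw [show (32 : ℕ) = 2 ^ 5 by norm_num, Nat.primeFactors_prime_pow (by norm_num) Nat.prime_two]; simp [h2]
    · exact absurd hpp (not_isPrimePow_of_two_primes_dvd Nat.prime_three (by norm_num : Nat.Prime 11) (by norm_num)
        (by norm_num) (by norm_num))
    · exact absurd hpp (by decide)
    · exact absurd hpp (not_isPrimePow_of_two_primes_dvd (by norm_num : Nat.Prime 5) (by norm_num : Nat.Prime 7) (by norm_num)
        (by norm_num) (by norm_num))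
    · exact absurd hpp (by decide)
    · rw [(by norm_num : Nat.Prime 37).primeFactors]; simp [h37]
    · exact absurd hpp (by decide)
    · exact absurd hpp (not_isPrimePow_of_two_primes_dvd Nat.prime_three (by norm_num : Nat.Prime 13) (by norm_num)
        (by norm_num) (by norm_num))
    · exact absurd hpp (by decide)
    · rw [(by norm_num : Nat.Prime 41).primeFactors]; simp [h41]
    · exact absurd hpp (by decide)
  · have h := weilSemilocalThreshold_uptoThirtySeven_lt_log_fortythree_half
    norm_num
    exact h

/-- **`a*(S) ≤ 15/8` for every finite set of primes `S` with `2, …, 37 ∈ S`, `41 ∉ S`.** -/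
theorem weilSemilocalThreshold_le_of_mem_thirtyseven {S : Finset ℕ} (h2 : 2 ∈ S) (h3 : 3 ∈ S) (h5 : 5 ∈ S) (h7 : 7 ∈ S) (h11 : 11 ∈ S) (h13 : 13 ∈ S) (h17 : 17 ∈ S) (h19 : 19 ∈ S) (h23 : 23 ∈ S) (h29 : 29 ∈ S) (h31 : 31 ∈ S) (h37 : 37 ∈ S)
    (h41 : 41 ∉ S) : weilSemilocalThreshold S ≤ ((15 / 8 : ℚ) : ℝ) := by
  rw [weilSemilocalThreshold_eq_uptoThirtySeven h2 h3 h5 h7 h11 h13 h17 h19 h23 h29 h31 h37 h41]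
  exact weilSemilocalThreshold_uptoThirtySeven_le

/-- **The bracket of the class `2, …, 37 ∈ S ∌ 41`**: `4023/5000 ≤ a*(S) ≤ 15/8` (DATA `a*(S_41) ≈ 1.856850`). -/
theorem weilSemilocalThreshold_mem_Icc_of_mem_thirtyseven {S : Finset ℕ} (h2 : 2 ∈ S) (h3 : 3 ∈ S) (h5 : 5 ∈ S) (h7 : 7 ∈ S) (h11 : 11 ∈ S) (h13 : 13 ∈ S) (h17 : 17 ∈ S) (h19 : 19 ∈ S) (h23 : 23 ∈ S) (h29 : 29 ∈ S) (h31 : 31 ∈ S) (h37 : 37 ∈ S)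
    (h41 : 41 ∉ S) : weilSemilocalThreshold S ∈ Set.Icc (4023 / 5000 : ℝ) ((15 / 8 : ℚ) : ℝ) :=
  ⟨SemilocalTwoThree.le_weilSemilocalThreshold_of_two_three_8046 h2 h3,
    weilSemilocalThreshold_le_of_mem_thirtyseven h2 h3 h5 h7 h11 h13 h17 h19 h23 h29 h31 h37 h41⟩

end Summit.RiemannHypothesis.RiemannHypothesis.Theorems.SemilocalPolyWitness

end

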